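import Summits.Schanuel.Schanuel.Theorems.RootDecomp1KSumFormBridge02

/-!
# RootDecomp1KSumFormBridge — lens 1, generation 41 «SUM-FORM BRIDGE»: the NAMED E-side input `SumFormExpPairMeasure` (CONJECTURE / IDEA-NEEDED, Mahler's problem in sum form) ⟹ a.i. (ℓ, e^ℓ) for every real Liouville ℓ ⟹ 33364's named first open cell (ℓ_b, ℓ_b²) — a REDUCTION (K-R27′), no cell credit — EDITION 2 (+ §9 the door (T⁺⁺) as a typed SOCKET) — continuation (RootDecomp1KSumFormBridge03): §4 the bridge + §5 the cells decided MOD the sum form (33364's named cell (ℓ_b, ℓ_b²), the Liouville pair sector) + §6 the ladder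

(lens-1 g41 `RootDecomp1KSumFormBridge.lean` EDITION 2 [HOME/decomp-schanuel-lens-1/g41/ sha256 f8db09bf…, 1674 l; NODE L1914 / REQUEST L1915 / EDITION 2 NOTE L1923; critic VERDICT L1925 (REDUCTION of record, (ε) booking, no credit, port GO)]; port by census-1 gen 17 as
`RootDecomp1KSumFormBridge01`–`06` — see the PORT NOTE of part 01; `--supports stmt-Schanuel-33364`; a REDUCTION to an OPEN conjecture (K-R27′); rung 0.)
-/

noncomputable section

open Complex Polynomial Filter
open scoped Topology

namespace Summit.Schanuel.Schanuel.Theorems.RootDecomp1KSumFormBridge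

open Summit.Schanuel.Schanuel.Theorems.RootDecomp1KHyper
open Summit.Schanuel.Schanuel.Theorems.RootDecomp1KHyper.HyperCell
open Summit.Schanuel.Schanuel.Theorems.RootDecomp1KGeneric
open Literature.NumberTheory.Transcendental (NesterenkoWaldschmidt1996_thm_1 weilHeight₁)

variable {K : ℕ}

/-- `1 ≤ log x` for `x ≥ 3`. -/
private theorem one_le_log_of_three_le {x : ℝ} (hx : 3 ≤ x) : 1 ≤ Real.log x := by
  rw [Real.le_log_iff_exp_le (by linarith)]
  have := Real.exp_one_lt_d9
  linarith

/-! ## §4  The bridge: the sum form kills polynomial-quality approximations; the flagship -/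

/-- **The sum form forbids polynomial-quality approximations of `(u, e^u)`, `u ≠ 0`**: at degree
`≤ N₀` and heights `≤ 1 + c' log q` the sum-form measure is `exp(−κ'(1 + c') log q) = q^{−κ''}` with
`κ''` INDEPENDENT of `q`, against `q^{−m}` for every `m`.  (The product form only gives
`exp(−κ (log q)²)` here — the tree's `not_logSqPairApprox_of_NW` — which is why it stops at the
log-square class.) -/
theorem not_liouvillePairApprox_of_sumForm (hSF : SumFormExpPairMeasure) {u : ℂ} (hu0 : u ≠ 0) :
    ¬ LiouvillePairApprox u := by
  rintro ⟨N₀, c, h⟩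
  obtain ⟨κ, hκ⟩ := hSF ‖u‖ N₀
  set c' : ℝ := max c 1 with hc'
  have hc'1 : 1 ≤ c' := le_max_right _ _
  have hcc' : c ≤ c' := le_max_left _ _
  set κ' : ℝ := max κ 0 with hκ'
  have hκ'0 : 0 ≤ κ' := le_max_right _ _
  have hκκ' : κ ≤ κ' := le_max_left _ _
  obtain ⟨q, hmq, f, S, α, β, hfirr, hfdeg, hS0, hβf, hαS, hα0, hβ0, hdeg, hMS, hMf, hdist⟩ :=
    h (⌈κ' * (1 + c')⌉₊ + 3)
  have hq3 : (3 : ℝ) ≤ q := by exact_mod_cast (le_trans (by omega) hmq : 3 ≤ q)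
  have hlog1 : 1 ≤ Real.log q := one_le_log_of_three_le hq3
  have hlog0 : 0 ≤ Real.log q := by linarith
  obtain ⟨hαalg, hβalg, hD1, hDle, hhα, hhβ⟩ := pair_bounds f hfirr hfdeg hβf S hS0 hαS
  set L : ℝ := 1 + c' * Real.log q with hLdef
  have hcL0 : 0 ≤ c' * Real.log q := mul_nonneg (by linarith) hlog0
  have hL1 : 1 ≤ L := by linarith
  have hcl : c * Real.log q ≤ c' * Real.log q := mul_le_mul_of_nonneg_right hcc' hlog0
  have hdata : AlgPairData α β N₀ L :=
    ⟨hα0, hβ0, hαalg, hβalg, hDle.trans hdeg, hL1, by linarith, by linarith⟩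
  have hlow := hκ u α β L le_rfl hu0 hdata
  have hκL : κ * L ≤ κ' * (1 + c') * Real.log q := by
    have h1 : κ * L ≤ κ' * L := mul_le_mul_of_nonneg_right hκκ' (by linarith)
    have h2 : L ≤ (1 + c') * Real.log q := by rw [hLdef]; nlinarith
    calc κ * L ≤ κ' * L := h1
      _ ≤ κ' * ((1 + c') * Real.log q) := mul_le_mul_of_nonneg_left h2 hκ'0
      _ = κ' * (1 + c') * Real.log q := by ring
  have hlow' : Real.exp (-(κ' * (1 + c') * Real.log q)) ≤ ‖cexp u - α‖ + ‖u - β‖ :=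
    le_trans (Real.exp_le_exp.mpr (neg_le_neg hκL)) hlow
  have hup : Real.exp (-(((⌈κ' * (1 + c')⌉₊ + 3 : ℕ) : ℝ) * Real.log q)) ≤
      Real.exp (-(κ' * (1 + c') * Real.log q)) := by
    rw [Real.exp_le_exp, neg_le_neg_iff]
    refine mul_le_mul_of_nonneg_right ?_ hlog0
    push_cast
    linarith [Nat.le_ceil (κ' * (1 + c'))]
  linarith [hdist.trans_le hup]

/-- **FLAGSHIP (mod the sum form): for EVERY Liouville real `ℓ`, the numbers `ℓ` and `e^ℓ` are
algebraically independent over `ℚ`.**  The tree has this for hyper-Liouville `ℓ` (Hyper08/19) and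
for log-square-Liouville `ℓ` (Generic18) modulo NW96's product form; the whole Liouville class —
in particular Liouville's constants `ℓ_b`, which are NOT log-square Liouville (Generic21 P5) — is
reached by, and as far as this method goes only by, the sum form. -/
theorem algebraicIndependent_exp_of_liouville (hSF : SumFormExpPairMeasure) {ℓ : ℝ}
    (hℓ : Liouville ℓ) : AlgebraicIndependent ℚ ![(ℓ : ℂ), cexp ℓ] := by
  by_contra hdep
  have hℓ0 : (ℓ : ℂ) ≠ 0 := Complex.ofReal_ne_zero.mpr hℓ.irrational.ne_zero
  exact not_liouvillePairApprox_of_sumForm hSF hℓ0 (liouvillePairApprox_of_dependent hℓ hdep)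

/-! ## §5  The decided cells (mod the sum form): the named first open cell of 33364 and the Liouville pair sector -/

/-- **THE NAMED FIRST OPEN CELL, coordinates a.i.:** `ℓ_b = Σ_k b^{−k!}` and `e^{ℓ_b}` are
algebraically independent for every `b ≥ 2` (mod the sum form). -/
theorem algebraicIndependent_liouvilleNumber_exp (hSF : SumFormExpPairMeasure) {b : ℕ} (hb : 2 ≤ b) :
    AlgebraicIndependent ℚ ![((liouvilleNumber b : ℝ) : ℂ), cexp (liouvilleNumber b : ℝ)] :=
  algebraicIndependent_exp_of_liouville hSF (liouville_liouvilleNumber hb)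

/-- **33364 AT ITS NAMED FIRST OPEN CELL (mod the sum form): Schanuel's bound at `(ℓ_b, ℓ_b²)`**,
every `b ≥ 2` — the tree's conditional `sb_liouvilleNumber_sq_of_algebraicIndependent` (Hyper16,
«IDEA-NEEDED leaf») with its hypothesis DISCHARGED from the typed E-side statement. -/
theorem liouvilleNumber_sq_cell_of_sumForm (hSF : SumFormExpPairMeasure) {b : ℕ} (hb : 2 ≤ b) :
    SB 2 ![((liouvilleNumber b : ℝ) : ℂ), ((liouvilleNumber b : ℝ) : ℂ) ^ 2] :=
  sb_liouvilleNumber_sq_of_algebraicIndependent (algebraicIndependent_liouvilleNumber_exp hSF hb)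

/-- **The named cell in the item's own binder shape**: `(ℓ_b, ℓ_b²)` satisfies BOTH Diophantine
hypotheses of `FiniteOrderLiouvilleSchanuel` (tree, hypothesis-free) AND its conclusion (mod the
sum form). -/
theorem namedCell_in_scope_and_decided (hSF : SumFormExpPairMeasure) {b : ℕ} (hb : 2 ≤ b) :
    LinLiouville ![((liouvilleNumber b : ℝ) : ℂ), ((liouvilleNumber b : ℝ) : ℂ) ^ 2] ∧
      ¬ HyperLinLiouville ![((liouvilleNumber b : ℝ) : ℂ), ((liouvilleNumber b : ℝ) : ℂ) ^ 2] ∧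
      SB 2 ![((liouvilleNumber b : ℝ) : ℂ), ((liouvilleNumber b : ℝ) : ℂ) ^ 2] :=
  have h := liouvilleNumber_sq_cell hb
  ⟨h.2.2.1, h.2.2.2, liouvilleNumber_sq_cell_of_sumForm hSF hb⟩

/-- **Cell «(ℓ, w), any w», `ℓ` Liouville** (mod the sum form; `e^ℓ` load-bearing). -/
theorem sumFormCell_any (hSF : SumFormExpPairMeasure) {ℓ : ℝ} (hℓ : Liouville ℓ) (w : ℂ) :
    SB 2 ![(ℓ : ℂ), w] :=
  sb_two_of_algebraicIndependent_exp 0 (by simpa using algebraicIndependent_exp_of_liouville hSF hℓ)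

/-- **Cell `(ℓ, ℓ²)`, `ℓ` ANY Liouville real** (mod the sum form): ℚ-free, in the scopes of S_L′
(31077) and A₃ (`LinLiouville`), and Schanuel's bound holds. -/
theorem sumFormCell_sq (hSF : SumFormExpPairMeasure) {ℓ : ℝ} (hℓ : Liouville ℓ) :
    LinearIndependent ℚ ![(ℓ : ℂ), (ℓ : ℂ) ^ 2] ∧ CoordLiouvilleSpan ![(ℓ : ℂ), (ℓ : ℂ) ^ 2] ∧
      LinLiouville ![(ℓ : ℂ), (ℓ : ℂ) ^ 2] ∧ SB 2 ![(ℓ : ℂ), (ℓ : ℂ) ^ 2] := by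
  have hℓ0 : (ℓ : ℂ) ≠ 0 := Complex.ofReal_ne_zero.mpr hℓ.irrational.ne_zero
  have hz : LinearIndependent ℚ ![(ℓ : ℂ), (ℓ : ℂ) * ℓ] :=
    linearIndependent_pair_of_irrational hℓ0 hℓ.irrational
  rw [sq]
  exact ⟨hz, ⟨(ℓ : ℂ), Submodule.subset_span ⟨0, by simp⟩, Or.inl (by simpa using hℓ)⟩,
    linLiouville_of_liouville_ratio hℓ (ℓ : ℂ), sumFormCell_any hSF hℓ _⟩

/-- **A₄ᵈ-placement**: for `ℓ` Liouville but NOT hyper-Liouville — e.g. every `ℓ_b` — the pair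
`(ℓ, ℓ²)` satisfies BOTH hypotheses of `FiniteOrderLiouvilleSchanuel` (33364), and its conclusion
holds (mod the sum form): the ENTIRE one-parameter family of 33364's first open cells is decided by
the one named input. -/
theorem sumFormCell_sq_in_finiteOrder_scope (hSF : SumFormExpPairMeasure) {ℓ : ℝ}
    (hℓ : Liouville ℓ) (hnot : ¬ HyperLiouville ℓ) :
    LinLiouville ![(ℓ : ℂ), (ℓ : ℂ) ^ 2] ∧ ¬ HyperLinLiouville ![(ℓ : ℂ), (ℓ : ℂ) ^ 2] ∧
      SB 2 ![(ℓ : ℂ), (ℓ : ℂ) ^ 2] := by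
  have h := sumFormCell_sq hSF hℓ
  refine ⟨h.2.2.1, ?_, h.2.2.2⟩
  rw [sq]
  have hz : LinearIndependent ℚ ![(ℓ : ℂ), (ℓ : ℂ) * ℓ] := by have := h.1; rwa [sq] at this
  exact not_hyperLinLiouville_of_ratio_not_hyperLiouville hnot hz

/-- **Span cell (mod the sum form).**  Schanuel's bound at EVERY pair `z` whose ℚ-span contains a
real Liouville number `ℓ` (clear denominators: `Mℓ = a z₀ + b z₁`, and `Mℓ` is again Liouville). -/
theorem sb_two_of_liouville_mem_span (hSF : SumFormExpPairMeasure) {z : Fin 2 → ℂ}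
    {ℓ : ℝ} (hℓ : Liouville ℓ) (hmem : (ℓ : ℂ) ∈ Submodule.span ℚ (Set.range z)) : SB 2 z := by
  obtain ⟨cf, hcf⟩ := (Submodule.mem_span_range_iff_exists_fun ℚ).mp hmem
  have hsum : ((cf 0 : ℚ) : ℂ) * z 0 + ((cf 1 : ℚ) : ℂ) * z 1 = (ℓ : ℂ) := by
    simpa [Fin.sum_univ_two, Rat.smul_def] using hcf
  set M : ℕ := (cf 0).den * (cf 1).den with hM
  have hM1 : 1 ≤ M := Nat.mul_pos (cf 0).den_pos (cf 1).den_pos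
  set a : ℤ := (cf 0).num * (cf 1).den with ha
  set b : ℤ := (cf 1).num * (cf 0).den with hb
  have hMa : (M : ℚ) * cf 0 = a := by
    rw [hM, ha]; push_cast
    have h := Rat.mul_den_eq_num (cf 0)
    calc ((cf 0).den : ℚ) * (cf 1).den * cf 0 = (cf 0 * (cf 0).den) * (cf 1).den := by ring
      _ = (cf 0).num * (cf 1).den := by rw [h]
  have hMb : (M : ℚ) * cf 1 = b := by
    rw [hM, hb]; push_cast
    have h := Rat.mul_den_eq_num (cf 1)
    calc ((cf 0).den : ℚ) * (cf 1).den * cf 1 = (cf 1 * (cf 1).den) * (cf 0).den := by ring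
      _ = (cf 1).num * (cf 0).den := by rw [h]
  have ha' : (a : ℂ) = (M : ℂ) * ((cf 0 : ℚ) : ℂ) := by exact_mod_cast hMa.symm
  have hb' : (b : ℂ) = (M : ℂ) * ((cf 1 : ℚ) : ℂ) := by exact_mod_cast hMb.symm
  have e1 : (((M : ℝ) * ℓ : ℝ) : ℂ) = (a : ℂ) * z 0 + (b : ℂ) * z 1 := by
    rw [ha', hb']; push_cast; rw [← hsum]; ring
  have hmem1 : (((M : ℝ) * ℓ : ℝ) : ℂ) ∈ IntermediateField.adjoin ℚ (SFset z ∪ {I}) := by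
    rw [e1]
    exact add_mem (mul_mem (intCast_mem _ a) (mem_adjoin_SFset_I (Or.inl ⟨0, rfl⟩)))
      (mul_mem (intCast_mem _ b) (mem_adjoin_SFset_I (Or.inl ⟨1, rfl⟩)))
  have hmem2 : cexp (((M : ℝ) * ℓ : ℝ) : ℂ) ∈ IntermediateField.adjoin ℚ (SFset z ∪ {I}) := by
    rw [e1, Complex.exp_add, Complex.exp_int_mul, Complex.exp_int_mul]
    exact mul_mem (zpow_mem (mem_adjoin_SFset_I (Or.inr ⟨0, rfl⟩)) a)
      (zpow_mem (mem_adjoin_SFset_I (Or.inr ⟨1, rfl⟩)) b)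
  exact sb_two_of_algebraicIndependent
    (algebraicIndependent_exp_of_liouville hSF (liouville_nat_mul hℓ hM1)) hmem1 hmem2

/-- **Item 31077 (`CoordLiouvilleSchanuel`) at `n = 2`, sub-scope «the span contains a REAL
Liouville number» (`w.im = 0`, `Liouville w.re`): HOLDS mod the sum form** — the tree's
`coordLiouvilleSchanuel_two_of_logSq` with the log-square restriction REMOVED. -/
theorem coordLiouvilleSchanuel_two_of_real_liouville (hSF : SumFormExpPairMeasure) (z : Fin 2 → ℂ)
    (_hz : LinearIndependent ℚ z)
    (hw : ∃ w ∈ Submodule.span ℚ (Set.range z), w.im = 0 ∧ Liouville w.re) : SB 2 z := by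
  obtain ⟨w, hw, him, hre⟩ := hw
  have e : ((w.re : ℝ) : ℂ) = w := by
    apply Complex.ext <;> simp [him]
  exact sb_two_of_liouville_mem_span hSF hre (by rw [e]; exact hw)

/-- **Item 33364 (`FiniteOrderLiouvilleSchanuel`) at `n = 2`, sub-scope «the span contains a real
Liouville number»: HOLDS mod the sum form** (its two Diophantine hypotheses are not even used; the
named cell `(ℓ_b, ℓ_b²)` is the instance `z = (ℓ_b, ℓ_b²)`, `ℓ = ℓ_b`). -/
theorem finiteOrderLiouvilleSchanuel_two_of_real_liouville (hSF : SumFormExpPairMeasure)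
    (z : Fin 2 → ℂ) (_hz : LinearIndependent ℚ z) (_hA : LinLiouville z)
    (_hB : ¬ HyperLinLiouville z)
    (hw : ∃ ℓ : ℝ, Liouville ℓ ∧ (ℓ : ℂ) ∈ Submodule.span ℚ (Set.range z)) : SB 2 z := by
  obtain ⟨ℓ, hℓ, hmem⟩ := hw
  exact sb_two_of_liouville_mem_span hSF hℓ hmem

/-! ## §6  The ladder at the named cell (lens 1: where the theorems stop, and what exactly is missing) -/

/-- **THE LADDER AT `(ℓ_b, ℓ_b²)`**, every `b ≥ 2`, all four rungs kernel-checked: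
(1) the PRODUCT form is a THEOREM modulo the registered fact NW 1996 Thm 1;
(2) the product-form extraction provably does NOT reach `ℓ_b` (`ℓ_b` is not log-square Liouville —
tree, hypothesis-free);
(3) the SUM form is a STRENGTHENING of the product form (same binders, `L` for `L²`);
(4) the SUM form DECIDES the cell (Schanuel's bound at `(ℓ_b, ℓ_b²)`).
So the exact grade where the theorems stop is the exponent of `L` in the bounded-degree pair
measure: `2` proved, `1` needed; nothing in between is claimed. -/
theorem namedCell_ladder {b : ℕ} (hb : 2 ≤ b) :
    (NesterenkoWaldschmidt1996_thm_1 → ProductFormExpPairMeasure) ∧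
      ¬ LogSqLiouville (liouvilleNumber b) ∧
      (SumFormExpPairMeasure → ProductFormExpPairMeasure) ∧
      (SumFormExpPairMeasure →
        SB 2 ![((liouvilleNumber b : ℝ) : ℂ), ((liouvilleNumber b : ℝ) : ℂ) ^ 2]) :=
  ⟨productForm_of_NW, not_logSqLiouville_liouvilleNumber hb, productForm_of_sumForm,
    fun hSF => liouvilleNumber_sq_cell_of_sumForm hSF hb⟩

end Summit.Schanuel.Schanuel.Theorems.RootDecomp1KSumFormBridge

end
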